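import Literature.NumberTheory.PAdicHodge.AinfRamifiedDivisionTransport
import Literature.NumberTheory.PAdicHodge.BmaxPlusFormalLogPeriodMap
import Literature.NumberTheory.PAdicHodge.BmaxPlusTatePeriodHom
import Literature.NumberTheory.PAdicHodge.AinfDivisionTowerNilpotence
import HarnessLib

/-!
# The TRANSPORTED `A_max`-period map of a ramified good model: `P0 : T_pŴ_D(𝒪_{ℂ_F}) →+ A_max`, `τ ↦ Λ_e(ι[T̃τ], z)` along the CM-fibre transport
# `T` — additive, `ℤ_p`-linear, `Γ_F`-equivariant (no Frobenius on `A_inf ⊗ 𝒪_D`, no Breuil–Kisin module)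

Topic `Literature/NumberTheory/PAdicHodge`; namespace `Literature.NumberTheory.PAdicHodge.AinfRamTop`. THEOREMS ONLY (no definition, no named fact, no instance,
no `sorry`). Setting: `F` a `p`-adic field with `θ` onto, `D` an Eisenstein datum (`𝒪_D = ℤ_p[ϖ]`, `e = [ℚ_p(ϖ):ℚ_p]`, `‖ϖ‖^e = ‖p‖`), `W = W_D` a Weierstrass equation over
`𝒪_D` read on `𝒪_F` through a bridge `ψ` (`AinfRamifiedTateModule`: Tate module `TatePtO F (W ⊗_ψ 𝒪_F) p`, coordinate towers `seqO τ`, `[p]_{W_D} = AinfRamTop.mulPC W`),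
`E₀/ℤ` with `W_D ≡ E₀ ⊗ 𝒪_D (mod ϖ)` (`hWE`), the CM-fibre transport `T` (`AinfRamifiedDivisionTransport.exists_unique_int_divisionSeq_of_ramified`: the unique exact
`[p]_{E₀}`-tower `‖ϖ‖`-close to a `[p]_{W_D}`-tower), Fontaine's integral `[w̃] = divisionLiftPt E₀ hθ w` and the `A_max`-period `Λ_N(ι[w̃], z)` (`PadicLogSeries.logSum`).

* §1 `exists_formalGroupLaw_sub_eq_C_mul_of_map_eq`, `norm_ramified_addWC_sub_le` (**`‖F_{W₁}(s,t) − F_{W₂}(s,t)‖ ≤ ‖c‖`** for `W₁ ≡ W₂ (mod c)`),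
  `coe_ramified_addWC_map_int` (`⊕_{E₀ ⊗ 𝒪_D} = ⊕_{E₀}`), `norm_addSeq_sub_int_addSeq_le` (`‖(v ⊕_{W_D} v')ₙ − (v ⊕_{E₀} v')ₙ‖ ≤ ‖ϖ‖`).
* §2 ★ `transport_addSeq_eq` — **`T(v ⊕_{W_D} v') = Tv ⊕_{E₀} Tv'`**; `norm_transport_zero_le` / `norm_transport_zero_pow_le` (**`‖(Tv)₀‖ ≤ ‖ϖ‖`, `‖(Tv)₀‖^e ≤ ‖p‖`**
  for a torsion tower `v`, `v₀ = 0`: the transported tower is DEEP of index `e`, uniformly).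
* §3 ★ `map_smul_eq_mul_of_addMonoidHom` — ANY additive map from a `ℤ_p`-module to `A_max` is `ℤ_p`-linear (`c = r + pⁿd`, `A_max` is `p`-adically separated).
* §4 ★★★ `exists_transportedPeriodHom` — **there is an additive `P0 : TatePtO F (W ⊗_ψ 𝒪_F) p →+ A_max` with `P0 τ = Λ_e(ι[w̃], z)` for EVERY exact `[p]_{E₀}`-tower
  `w` that is `‖ϖ‖`-close to `seqO τ` and EVERY witness `z`** (so `P0 τ = Λ_e(ι[T̃τ], ·)`), which is `ℤ_p`-linear (`P0(c·τ) = ι(c)·P0 τ`) and `Γ_F`-equivariant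
  (`σ(P0 τ) = P0(σ·τ)`): the transported crystalline period `P0 = Λ ∘ T` of memo §2 T2; `Q⁰ := φ ∘ P0`.

Purpose (crux K★ `stmt-BirchSwinnertonDyer-22226`, line `kato_lever`, memo `Lines/kato-lever-K2-ramified-cm-transport.md` §10, step T5): with `f = bmaxPlusToBdR`, the
Hodge-line coefficients `A, B` (p770176) and `emb : F ↪ B_dR⁺`, `Pω″ := emb A·f∘P0 + emb B·f∘φ∘P0` is `Fil¹`-valued on `T_pŴ_D`
(`AinfRamifiedTransportedPeriodsTheta…_eq_zero_of_torsion`) and its integrating element at a rational point has `θ`-value `p^e·log_{W_D}(P)`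
(`thetaBdR_transportedHodgeCombination_eq`); the Honda relation / `φD = pD` / (K₂) normal form hold VERBATIM for `P0` (p764364/p765058 at the exact `E₀`-towers
`Tτ`). Infrastructure only; BSD / K★ are not proved by any of this.

## References
* P. Colmez, *Périodes p-adiques des variétés abéliennes*, Math. Ann. 292 (1992), §2. [Colmez1992PeriodesAbeliennes]
* N. M. Katz, *Crystalline cohomology, Dieudonné modules, and Jacobi sums* (1981), Thm. 5.1.4–5.1.5 (morphisms of reductions act on the `D` of lifts).
  [Katz1981CrystallineDieudonne]
* J.-M. Fontaine, *Le corps des périodes p-adiques*, Astérisque 223 (1994), Exp. II §1.2.2, §1.5. [FontaineAsterisque223III]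
* J. H. Silverman, *The Arithmetic of Elliptic Curves* (2009), IV.2.3, VII.§1. [SilvermanAEC2009]
-/

noncomputable section

open PowerSeries Filter Topology Field WittVector ValuativeRel
open scoped Classical

namespace Literature.NumberTheory.PAdicHodge

namespace AinfRamTop

open Literature.NumberTheory.GaloisRepresentations Literature.NumberTheory.GaloisRepresentations.IsNonarchimedeanLocalField
open Literature.NumberTheory.GaloisRepresentations.LubinTate Literature.NumberTheory.EllipticCurves
open Literature.RingTheory.FormalGroups Literature.AlgebraicGeometry.Resolution

variable {F : Type} [Field F] [ValuativeRel F] [TopologicalSpace F] [IsNonarchimedeanLocalField F] [CharZero F]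
  {p : ℕ} [hpp : Fact p.Prime] {hp : valuation F p < 1} (D : EisensteinRoot F p hp)
  [Fact (¬ IsUnit (p : integerC F))]

/-! ## §1 Group laws congruent modulo `ϖ` -/

omit hpp in
/-- **Functoriality of the chord–tangent law under reduction**: if `W₁ ≡ W₂ (mod c)` then `F_{W₁} − F_{W₂} ∈ c·R⟦X,Y⟧`. [cite: SilvermanAEC2009, IV.2.3] -/
theorem exists_formalGroupLaw_sub_eq_C_mul_of_map_eq {R : Type*} [CommRing R] (c : R) (W₁ W₂ : WeierstrassCurve R)
    (h : W₁.map (Ideal.Quotient.mk (Ideal.span {c})) = W₂.map (Ideal.Quotient.mk (Ideal.span {c}))) :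
    ∃ G : MvPowerSeries (Fin 2) R, W₁.formalGroupLaw - W₂.formalGroupLaw = MvPowerSeries.C c * G := by
  have hcoeff : ∀ d, c ∣ MvPowerSeries.coeff d (W₁.formalGroupLaw - W₂.formalGroupLaw) := fun d => by
    rw [← Ideal.mem_span_singleton, ← Ideal.Quotient.eq_zero_iff_mem, map_sub, map_sub, sub_eq_zero, ← MvPowerSeries.coeff_map,
      ← MvPowerSeries.coeff_map, WeierstrassCurve.map_formalGroupLaw, WeierstrassCurve.map_formalGroupLaw, h]
  refine ⟨fun d => Classical.choose (hcoeff d), MvPowerSeries.ext fun d => ?_⟩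
  rw [MvPowerSeries.coeff_C_mul]
  exact Classical.choose_spec (hcoeff d)

omit [Fact (¬ IsUnit (p : integerC F))] in
/-- ★ **`‖F_{W₁}(s,t) − F_{W₂}(s,t)‖ ≤ ‖c‖`** on `Ŵ(𝔪_{ℂ_F})` for Weierstrass equations `W₁ ≡ W₂ (mod c)` over `𝒪_D` (`addWC`).
[cite: SilvermanAEC2009, IV.2.3] [cite: Katz1981CrystallineDieudonne, Thm. 5.1.4] -/
theorem norm_ramified_addWC_sub_le (c : EisensteinRoot.CoeffDisc D) (W₁ W₂ : WeierstrassCurve (EisensteinRoot.CoeffDisc D))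
    (h : W₁.map (Ideal.Quotient.mk (Ideal.span {c})) = W₂.map (Ideal.Quotient.mk (Ideal.span {c}))) (s t : (maxNilIdealC F).toIdeal) :
    ‖(((addWC (D := D) W₁ s t : (maxNilIdealC F).toIdeal) : CBall F) : CompletedAlgClosure F) -
        (((addWC (D := D) W₂ s t : (maxNilIdealC F).toIdeal) : CBall F) : CompletedAlgClosure F)‖ ≤
      ‖((algebraMap (EisensteinRoot.CoeffDisc D) (CBall F) c : CBall F) : CompletedAlgClosure F)‖ := by
  obtain ⟨G, hG⟩ := exists_formalGroupLaw_sub_eq_C_mul_of_map_eq c W₁ W₂ h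
  have hev := (maxNilIdealC F).hasEval ![s, t]
  rw [addWC, addWC, coe_evalPt, coe_evalPt, ← AddSubgroupClass.coe_sub, ← map_sub, hG, map_mul,
    show (MvPowerSeries.C c : MvPowerSeries (Fin 2) (EisensteinRoot.CoeffDisc D)) = algebraMap _ _ c from rfl, AlgHom.commutes,
    Subring.coe_mul, norm_mul]
  exact mul_le_of_le_one_right (norm_nonneg _) ((mem_unitBall_iff _).mp (MvPowerSeries.aeval hev G).2)

omit [Fact (¬ IsUnit (p : integerC F))] in
/-- The structure maps `ℤ → 𝒪_{ℂ_F}` and `ℤ → 𝒪_D → 𝒪_{ℂ_F}` agree. [folklore] -/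
private theorem algebraMap_coeffDisc_algebraMap_int' (a : ℤ) :
    algebraMap (EisensteinRoot.CoeffDisc D) (CBall F) (algebraMap ℤ (EisensteinRoot.CoeffDisc D) a) = algebraMap ℤ (CBall F) a := by
  rw [algebraMap_int_eq, algebraMap_int_eq, eq_intCast, eq_intCast, map_intCast]

omit [Fact (¬ IsUnit (p : integerC F))] in
/-- **`⊕_{E₀ ⊗ 𝒪_D} = ⊕_{E₀}` on `Ŵ(𝔪_{ℂ_F})`** (change of coefficients in the evaluation). [cite: SilvermanAEC2009, IV.2.3] -/
theorem coe_ramified_addWC_map_int (E₀ : WeierstrassCurve ℤ) (s t : (maxNilIdealC F).toIdeal) :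
    addWC (D := D) (E₀.map (algebraMap ℤ (EisensteinRoot.CoeffDisc D))) s t = AinfTop.addWC F E₀ s t := by
  rw [addWC, AinfTop.addWC]
  have key : ∀ (f₁ f₂ : MvPowerSeries (Fin 2) (EisensteinRoot.CoeffDisc D)) (e : f₁ = f₂) (h₁ : f₁.constantCoeff = 0) (h₂ : f₂.constantCoeff = 0),
      evalPt (maxNilIdealC F) f₁ h₁ ![s, t] = evalPt (maxNilIdealC F) f₂ h₂ ![s, t] := by
    intro f₁ f₂ e h₁ h₂; subst e; rfl
  have hmap : (MvPowerSeries.map (algebraMap ℤ (EisensteinRoot.CoeffDisc D)) E₀.formalGroupLaw).constantCoeff = 0 := by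
    rw [MvPowerSeries.constantCoeff_map, E₀.constantCoeff_formalGroupLaw, map_zero]
  rw [key _ _ (WeierstrassCurve.map_formalGroupLaw (φ := algebraMap ℤ (EisensteinRoot.CoeffDisc D)) (W := E₀)).symm _ hmap]
  exact evalPt_map_of_algebraMap_eq (algebraMap ℤ (EisensteinRoot.CoeffDisc D)) (algebraMap_coeffDisc_algebraMap_int' D)
    (maxNilIdealC F) E₀.formalGroupLaw E₀.constantCoeff_formalGroupLaw hmap ![s, t]

omit [Fact (¬ IsUnit (p : integerC F))] in
/-- ★ **`‖(v ⊕_{W_D} v')ₙ − (v ⊕_{E₀} v')ₙ‖ ≤ ‖ϖ‖`** termwise, for `W_D ≡ E₀ ⊗ 𝒪_D (mod ϖ)`. [cite: Katz1981CrystallineDieudonne, Thm. 5.1.4] -/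
theorem norm_addSeq_sub_int_addSeq_le (W : WeierstrassCurve (EisensteinRoot.CoeffDisc D)) (E₀ : WeierstrassCurve ℤ)
    (hWE : W.map (Ideal.Quotient.mk (Ideal.span {EisensteinRoot.CoeffDisc.of D (AdjoinRoot.root D.poly)})) =
      (E₀.map (algebraMap ℤ (EisensteinRoot.CoeffDisc D))).map
        (Ideal.Quotient.mk (Ideal.span {EisensteinRoot.CoeffDisc.of D (AdjoinRoot.root D.poly)})))
    (v v' : ℕ → (maxNilIdealC F).toIdeal) (n : ℕ) :
    ‖(((addSeq (D := D) W v v' n : (maxNilIdealC F).toIdeal) : CBall F) : CompletedAlgClosure F) -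
        (((AinfTop.addSeq F E₀ v v' n : (maxNilIdealC F).toIdeal) : CBall F) : CompletedAlgClosure F)‖ ≤
      ‖((D.rootC : integerC F) : CompletedAlgClosure F)‖ := by
  rw [addSeq, AinfTop.addSeq, ← coe_ramified_addWC_map_int D E₀]
  refine (norm_ramified_addWC_sub_le D _ W _ hWE (v n) (v' n)).trans (le_of_eq ?_)
  rw [EisensteinRoot.coe_algebraMap_coeffDisc_cBall, EisensteinRoot.Coeff.toF_root, EisensteinRoot.coe_rootC]

/-! ## §2 The transport is additive; transported torsion towers are deep of index `e` -/

/-- ★ **`T(v ⊕_{W_D} v') = Tv ⊕_{E₀} Tv'`**: if `w, w'` are exact `[p]_{E₀}`-towers `‖ϖ‖`-close to `v, v'` and `u` is an exact `[p]_{E₀}`-tower `‖ϖ‖`-close to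
`v ⊕_{W_D} v'`, then `u = w ⊕_{E₀} w'` (`⊕_{W_D} ≡ ⊕_{E₀} (mod ϖ)`, `⊕_{E₀}` is `1`-Lipschitz, rigidity of `[p]`-towers).
[cite: Katz1981CrystallineDieudonne, Thm. 5.1.4–5.1.5] [cite: Colmez1992PeriodesAbeliennes, §2] -/
theorem transport_addSeq_eq (W : WeierstrassCurve (EisensteinRoot.CoeffDisc D)) (E₀ : WeierstrassCurve ℤ)
    (hWE : W.map (Ideal.Quotient.mk (Ideal.span {EisensteinRoot.CoeffDisc.of D (AdjoinRoot.root D.poly)})) =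
      (E₀.map (algebraMap ℤ (EisensteinRoot.CoeffDisc D))).map
        (Ideal.Quotient.mk (Ideal.span {EisensteinRoot.CoeffDisc.of D (AdjoinRoot.root D.poly)})))
    {v v' w w' : ℕ → (maxNilIdealC F).toIdeal}
    (hw : ∀ n, AinfTop.mulPC F p E₀ (w (n + 1)) = w n) (hw' : ∀ n, AinfTop.mulPC F p E₀ (w' (n + 1)) = w' n)
    (hwv : ∀ n, ‖(((w n : (maxNilIdealC F).toIdeal) : CBall F) : CompletedAlgClosure F) -
      (((v n : (maxNilIdealC F).toIdeal) : CBall F) : CompletedAlgClosure F)‖ ≤ ‖((D.rootC : integerC F) : CompletedAlgClosure F)‖)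
    (hw'v' : ∀ n, ‖(((w' n : (maxNilIdealC F).toIdeal) : CBall F) : CompletedAlgClosure F) -
      (((v' n : (maxNilIdealC F).toIdeal) : CBall F) : CompletedAlgClosure F)‖ ≤ ‖((D.rootC : integerC F) : CompletedAlgClosure F)‖)
    (u : ℕ → (maxNilIdealC F).toIdeal) (hu : ∀ n, AinfTop.mulPC F p E₀ (u (n + 1)) = u n)
    (huv : ∀ n, ‖(((u n : (maxNilIdealC F).toIdeal) : CBall F) : CompletedAlgClosure F) -
      (((addSeq (D := D) W v v' n : (maxNilIdealC F).toIdeal) : CBall F) : CompletedAlgClosure F)‖ ≤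
        ‖((D.rootC : integerC F) : CompletedAlgClosure F)‖) :
    u = AinfTop.addSeq F E₀ w w' := by
  refine AinfTop.addSeq_eq_of_divisionSeq_norm_sub_le E₀ D.norm_rootC_lt_one hw hw' hwv hw'v' u hu fun n => ?_
  have hsplit : ∀ a b c : CompletedAlgClosure F, a - c = (a - b) + (b - c) := fun a b c => by ring
  rw [hsplit _ (((addSeq (D := D) W v v' n : (maxNilIdealC F).toIdeal) : CBall F) : CompletedAlgClosure F)]
  exact (IsUltrametricDist.norm_add_le_max _ _).trans (max_le (huv n) (norm_addSeq_sub_int_addSeq_le D W E₀ hWE v v' n))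

omit [Fact (¬ IsUnit (p : integerC F))] in
/-- **`‖w₀‖ ≤ ‖ϖ‖`** for a tower `w` `‖ϖ‖`-close to a tower `v` with `v₀ = 0`. [cite: Colmez1992PeriodesAbeliennes, §2] -/
theorem norm_transport_zero_le {v w : ℕ → (maxNilIdealC F).toIdeal} (hv0 : ((v 0 : (maxNilIdealC F).toIdeal) : CBall F) = 0)
    (hwv : ∀ n, ‖(((w n : (maxNilIdealC F).toIdeal) : CBall F) : CompletedAlgClosure F) -
      (((v n : (maxNilIdealC F).toIdeal) : CBall F) : CompletedAlgClosure F)‖ ≤ ‖((D.rootC : integerC F) : CompletedAlgClosure F)‖) :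
    ‖(((w 0 : (maxNilIdealC F).toIdeal) : CBall F) : CompletedAlgClosure F)‖ ≤ ‖((D.rootC : integerC F) : CompletedAlgClosure F)‖ := by
  have h := hwv 0
  have hv0' : (((v 0 : (maxNilIdealC F).toIdeal) : CBall F) : CompletedAlgClosure F) = 0 := by rw [hv0]; rfl
  rwa [hv0', sub_zero] at h

omit [Fact (¬ IsUnit (p : integerC F))] in
/-- ★ **Transported torsion towers are DEEP of index `e`: `‖w₀‖^e ≤ ‖p‖`** (`‖ϖ‖^e = ‖p‖`) — the uniform nilpotence index of `[w̃]` for the whole Tate module.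
[cite: Colmez1992PeriodesAbeliennes, §2] [cite: SerreLocalFields1979, Ch. I §6 Prop. 18] -/
theorem norm_transport_zero_pow_le {v w : ℕ → (maxNilIdealC F).toIdeal} (hv0 : ((v 0 : (maxNilIdealC F).toIdeal) : CBall F) = 0)
    (hwv : ∀ n, ‖(((w n : (maxNilIdealC F).toIdeal) : CBall F) : CompletedAlgClosure F) -
      (((v n : (maxNilIdealC F).toIdeal) : CBall F) : CompletedAlgClosure F)‖ ≤ ‖((D.rootC : integerC F) : CompletedAlgClosure F)‖) :
    ‖(((w 0 : (maxNilIdealC F).toIdeal) : CBall F) : CompletedAlgClosure F)‖ ^ D.e ≤ ‖(p : CompletedAlgClosure F)‖ := by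
  rw [← D.norm_rootC_pow]
  exact pow_le_pow_left₀ (norm_nonneg _) (norm_transport_zero_le D hv0 hwv) _

/-! ## §3 Additive maps into `A_max` are `ℤ_p`-linear -/

variable [IsAdicComplete (Ideal.span {(p : integerC F)}) (integerC F)]

omit [CharZero F] [IsAdicComplete (Ideal.span {(p : integerC F)}) (integerC F)] in
set_option maxHeartbeats 3200000 in
/-- ★ **Any additive map `L` from a `ℤ_p`-module into `A_max` is `ℤ_p`-linear**: `L(c·m) = ι(c)·L(m)` (write `c = r + pⁿd` with `r ∈ ℕ` (`PadicInt.appr`), so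
`L(c·m) − ι(c)L(m) = pⁿ(L(d·m) − ι(d)L(m))` for every `n`, and `A_max` is `p`-adically separated, `eq_zero_of_forall_exists_pow_mul`).
[cite: FontaineAsterisque223III, Exp. II §1.5] -/
theorem map_smul_eq_mul_of_addMonoidHom {M : Type*} [AddCommGroup M] [Module ℤ_[p] M] (L : M →+ BmaxPlus F p) (c : ℤ_[p]) (m : M) :
    L (c • m) = ainfToBmaxPlus F p (zpToAinf c) * L m := by
  rw [← sub_eq_zero]
  refine AinfTop.eq_zero_of_forall_exists_pow_mul fun n => ?_
  obtain ⟨d, hd⟩ := Ideal.mem_span_singleton'.1 (PadicInt.appr_spec n c)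
  obtain ⟨r, hr⟩ : ∃ r : ℕ, c.appr n = r := ⟨_, rfl⟩
  rw [hr] at hd
  have hc : c = (r : ℤ_[p]) + (p : ℤ_[p]) ^ n * d := by rw [mul_comm, hd]; ring
  have hsmul : c • m = r • m + p ^ n • (d • m) := by
    rw [hc, add_smul, Nat.cast_smul_eq_nsmul, mul_smul, ← Nat.cast_pow, Nat.cast_smul_eq_nsmul]
  have hι : ainfToBmaxPlus F p (zpToAinf c) = (r : BmaxPlus F p) + (p : BmaxPlus F p) ^ n * ainfToBmaxPlus F p (zpToAinf d) := by
    rw [hc, map_add, map_mul, map_pow, map_natCast, map_natCast, map_add, map_mul, map_pow, map_natCast, map_natCast]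
  have h1 : L (r • m) = (r : BmaxPlus F p) * L m := by rw [map_nsmul, nsmul_eq_mul]
  have h2 : L (p ^ n • (d • m)) = (p : BmaxPlus F p) ^ n * L (d • m) := by rw [map_nsmul, nsmul_eq_mul, Nat.cast_pow]
  refine ⟨L (d • m) - ainfToBmaxPlus F p (zpToAinf d) * L m, ?_⟩
  rw [hsmul, map_add, h1, h2, hι]
  ring

/-! ## §4 The transported period map -/

variable {hθ : Function.Surjective (fontaineTheta (integerC F) p)}

set_option maxHeartbeats 3200000 in
/-- ★★★ **The transported `A_max`-period map `P0 = Λ ∘ T` on `T_pŴ_D(𝒪_{ℂ_F})`.** For `W_D ≡ E₀ ⊗ 𝒪_D (mod ϖ)` read through a bridge `ψ : 𝒪_D → 𝒪_F`, there is an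
ADDITIVE map `P0 : TatePtO F (W ⊗_ψ 𝒪_F) p →+ A_max` such that **`P0 τ = Λ_e(ι[w̃], z)` for every exact `[p]_{E₀}`-division tower `w` that is `‖ϖ‖`-close to the
coordinate tower `seqO τ`** (i.e. for the CM-fibre transport `w = Tτ`, index `N = e`, ANY witness `ι[w̃]^e = p·z`), which is moreover **`ℤ_p`-linear**
(`P0(c·τ) = ι(c)·P0 τ`) and **`Γ_F`-equivariant** (`σ(P0 τ) = P0(σ·τ)`). Additivity: `T` is additive (§2) + `divisionLiftPt_addSeq` +
`logSum_divisionLiftPt_addSeq` at the uniform depth `‖(Tτ)₀‖^e ≤ ‖p‖`; equivariance: `T` commutes with `Γ_F` (`galSeq_eq_of_divisionSeq_norm_sub_le`) +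
`galBmaxPlus_logSum_divisionLiftPt`. [cite: Colmez1992PeriodesAbeliennes, §2] [cite: Katz1981CrystallineDieudonne, Thm. 5.1.4–5.1.5]
[cite: FontaineAsterisque223III, Exp. II §1.2.2, §1.5] -/
theorem exists_transportedPeriodHom (W : WeierstrassCurve (EisensteinRoot.CoeffDisc D)) (E₀ : WeierstrassCurve ℤ)
    (hWE : W.map (Ideal.Quotient.mk (Ideal.span {EisensteinRoot.CoeffDisc.of D (AdjoinRoot.root D.poly)})) =
      (E₀.map (algebraMap ℤ (EisensteinRoot.CoeffDisc D))).map
        (Ideal.Quotient.mk (Ideal.span {EisensteinRoot.CoeffDisc.of D (AdjoinRoot.root D.poly)})))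
    (ψ : EisensteinRoot.CoeffDisc D →+* LTCoeff F) (hψ : ∀ c, algebraMap (LTCoeff F) F (ψ c) = EisensteinRoot.CoeffDisc.toF D c) :
    ∃ P0 : AinfTop.TatePtO F (W.map ψ) p →+ BmaxPlus F p,
      (∀ (τ : AinfTop.TatePtO F (W.map ψ) p) (w : ℕ → (maxNilIdealC F).toIdeal) (hw : ∀ n, AinfTop.mulPC F p E₀ (w (n + 1)) = w n),
        (∀ n, ‖(((w n : (maxNilIdealC F).toIdeal) : CBall F) : CompletedAlgClosure F) -
          (((AinfTop.seqO (W.map ψ) τ n : (maxNilIdealC F).toIdeal) : CBall F) : CompletedAlgClosure F)‖ ≤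
            ‖((D.rootC : integerC F) : CompletedAlgClosure F)‖) →
        ∀ z : bmaxZero F p,
          algebraMap (Ainf (p := p) F) (bmaxZero F p) ((AinfTop.of F p).symm
              (((AinfTop.divisionLiftPt E₀ hθ w hw).val : (AinfTop.nilTheta F p hθ).toIdeal) : AinfTop F p)) ^ D.e = (p : bmaxZero F p) * z →
          P0 τ = PadicLogSeries.logSum ((algebraMap (Ainf (p := p) F) (bmaxZero F p)).comp zpToAinf) (GaloisContinuity.formalLogNum E₀ p) D.e
            (algebraMap (Ainf (p := p) F) (bmaxZero F p) ((AinfTop.of F p).symm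
              (((AinfTop.divisionLiftPt E₀ hθ w hw).val : (AinfTop.nilTheta F p hθ).toIdeal) : AinfTop F p))) z) ∧
      (∀ (c : ℤ_[p]) (τ : AinfTop.TatePtO F (W.map ψ) p), P0 (c • τ) = ainfToBmaxPlus F p (zpToAinf c) * P0 τ) ∧
      (∀ (σ : absoluteGaloisGroup F) (τ : AinfTop.TatePtO F (W.map ψ) p), galBmaxPlus σ (P0 τ) = P0 (σ • τ)) := by
  haveI := isDomain_bmaxZero (F := F) (p := p)
  haveI := charZero_bmaxZero (F := F) (p := p)
  have he1 : 1 ≤ D.e := D.e_pos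
  -- the transport `T τ` of the coordinate tower of `τ`
  have hT : ∀ τ : AinfTop.TatePtO F (W.map ψ) p, ∃ w : ℕ → (maxNilIdealC F).toIdeal, (∀ n, AinfTop.mulPC F p E₀ (w (n + 1)) = w n) ∧
      ∀ n, ‖(((w n : (maxNilIdealC F).toIdeal) : CBall F) : CompletedAlgClosure F) -
        (((AinfTop.seqO (W.map ψ) τ n : (maxNilIdealC F).toIdeal) : CBall F) : CompletedAlgClosure F)‖ ≤
          ‖((D.rootC : integerC F) : CompletedAlgClosure F)‖ := fun τ =>
    (exists_unique_int_divisionSeq_of_ramified D W E₀ hWE (mulPC_seqO W ψ hψ τ)).exists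
  choose T hT hTτ using hT
  -- uniqueness of the transport
  have hTuniq : ∀ (τ : AinfTop.TatePtO F (W.map ψ) p) (w : ℕ → (maxNilIdealC F).toIdeal), (∀ n, AinfTop.mulPC F p E₀ (w (n + 1)) = w n) →
      (∀ n, ‖(((w n : (maxNilIdealC F).toIdeal) : CBall F) : CompletedAlgClosure F) -
        (((AinfTop.seqO (W.map ψ) τ n : (maxNilIdealC F).toIdeal) : CBall F) : CompletedAlgClosure F)‖ ≤
          ‖((D.rootC : integerC F) : CompletedAlgClosure F)‖) → w = T τ := fun τ w hw hwτ =>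
    (exists_unique_int_divisionSeq_of_ramified D W E₀ hWE (mulPC_seqO W ψ hψ τ)).unique ⟨hw, hwτ⟩ ⟨hT τ, hTτ τ⟩
  -- depth
  have hdepth : ∀ τ, ‖(((T τ 0 : (maxNilIdealC F).toIdeal) : CBall F) : CompletedAlgClosure F)‖ ^ D.e ≤ ‖(p : CompletedAlgClosure F)‖ := fun τ =>
    norm_transport_zero_pow_le D (AinfTop.seqO_zero (W.map ψ) τ) (hTτ τ)
  -- witnesses
  have hz : ∀ τ, ∃ z : bmaxZero F p, algebraMap (Ainf (p := p) F) (bmaxZero F p) ((AinfTop.of F p).symm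
      (((AinfTop.divisionLiftPt E₀ hθ (T τ) (hT τ)).val : (AinfTop.nilTheta F p hθ).toIdeal) : AinfTop F p)) ^ D.e = (p : bmaxZero F p) * z := by
    intro τ
    have hmem := AinfTop.pow_coe_val_nsmul_divisionLiftPt_mem E₀ (hθ := hθ) (hT τ) (hdepth τ) 1
    rw [one_nsmul] at hmem
    exact exists_algebraMap_pow_eq_natCast_mul hmem
  choose zf hzf using hz
  -- additivity of the transport
  have hTadd : ∀ τ τ', T (τ + τ') = AinfTop.addSeq F E₀ (T τ) (T τ') := fun τ τ' => by
    refine transport_addSeq_eq D W E₀ hWE (hT τ) (hT τ') (hTτ τ) (hTτ τ') (T (τ + τ')) (hT (τ + τ')) fun n => ?_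
    rw [← seqO_add_eq_addSeq W ψ hψ]
    exact hTτ (τ + τ') n
  -- Galois-compatibility of the transport
  have hTgal : ∀ (σ : absoluteGaloisGroup F) τ, T (σ • τ) = AinfTop.galSeq F σ (T τ) := fun σ τ => by
    refine AinfTop.galSeq_eq_of_divisionSeq_norm_sub_le E₀ hθ σ D.norm_rootC_lt_one (hT τ) (hTτ τ) (T (σ • τ)) (hT (σ • τ)) fun n => ?_
    rw [← AinfTop.seqO_smul]
    exact hTτ (σ • τ) n
  -- the period as a function and its additivity
  set L : AinfTop.TatePtO F (W.map ψ) p → BmaxPlus F p := fun τ =>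
    PadicLogSeries.logSum ((algebraMap (Ainf (p := p) F) (bmaxZero F p)).comp zpToAinf) (GaloisContinuity.formalLogNum E₀ p) D.e
      (algebraMap (Ainf (p := p) F) (bmaxZero F p) ((AinfTop.of F p).symm
        (((AinfTop.divisionLiftPt E₀ hθ (T τ) (hT τ)).val : (AinfTop.nilTheta F p hθ).toIdeal) : AinfTop F p))) (zf τ) with hL
  have hLadd : ∀ τ τ', L (τ + τ') = L τ + L τ' := by
    intro τ τ'
    -- the lift of `T(τ+τ') = Tτ ⊕ Tτ'` and its witness
    have hcongr : AinfTop.divisionLiftPt E₀ hθ (T (τ + τ')) (hT (τ + τ')) =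
        AinfTop.divisionLiftPt E₀ hθ (AinfTop.addSeq F E₀ (T τ) (T τ')) (AinfTop.mulPC_addSeq E₀ (hT τ) (hT τ')) :=
      AinfTop.divisionLiftPt_congr E₀ (hTadd τ τ') _ _
    have hz'' : algebraMap (Ainf (p := p) F) (bmaxZero F p) ((AinfTop.of F p).symm
        (((AinfTop.divisionLiftPt E₀ hθ (AinfTop.addSeq F E₀ (T τ) (T τ')) (AinfTop.mulPC_addSeq E₀ (hT τ) (hT τ'))).val :
          (AinfTop.nilTheta F p hθ).toIdeal) : AinfTop F p)) ^ D.e = (p : bmaxZero F p) * zf (τ + τ') := by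
      rw [← hcongr]; exact hzf (τ + τ')
    have key := AinfTop.logSum_divisionLiftPt_addSeq E₀ (hθ := hθ) (hT τ) (hT τ') he1 (hdepth τ) (hdepth τ') (hzf τ) (hzf τ') hz''
    rw [hL]
    simp only
    rw [hcongr]
    exact key
  refine ⟨AddMonoidHom.mk' L hLadd, fun τ w hw hwτ z hz => ?_, fun c τ => map_smul_eq_mul_of_addMonoidHom (AddMonoidHom.mk' L hLadd) c τ,
    fun σ τ => ?_⟩
  · -- characterisation: `w = T τ`, any witness
    have hwT : w = T τ := hTuniq τ w hw hwτ
    subst hwT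
    simp only [AddMonoidHom.mk'_apply, hL]
    exact PadicLogSeries.logSum_congr_witness _ _ (hzf τ) hz
  · -- `Γ_F`-equivariance
    simp only [AddMonoidHom.mk'_apply, hL]
    have h := AinfTop.galBmaxPlus_logSum_divisionLiftPt E₀ (hθ := hθ) (GaloisContinuity.formalLogNum E₀ p) σ (hT τ) D.e (zf τ)
    rw [h]
    have hcongr : AinfTop.divisionLiftPt E₀ hθ (AinfTop.galSeq F σ (T τ)) (AinfTop.mulPC_galSeq E₀ hθ σ (hT τ)) =
        AinfTop.divisionLiftPt E₀ hθ (T (σ • τ)) (hT (σ • τ)) :=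
      AinfTop.divisionLiftPt_congr E₀ (hTgal σ τ).symm _ _
    have hzσ : algebraMap (Ainf (p := p) F) (bmaxZero F p) ((AinfTop.of F p).symm
        (((AinfTop.divisionLiftPt E₀ hθ (AinfTop.galSeq F σ (T τ)) (AinfTop.mulPC_galSeq E₀ hθ σ (hT τ))).val :
          (AinfTop.nilTheta F p hθ).toIdeal) : AinfTop F p)) ^ D.e = (p : bmaxZero F p) * galBmaxZero σ (zf τ) := by
      have hval : galAinf σ ((AinfTop.of F p).symm (((AinfTop.divisionLiftPt E₀ hθ (T τ) (hT τ)).val :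
          (AinfTop.nilTheta F p hθ).toIdeal) : AinfTop F p)) =
          (AinfTop.of F p).symm (((AinfTop.divisionLiftPt E₀ hθ (AinfTop.galSeq F σ (T τ)) (AinfTop.mulPC_galSeq E₀ hθ σ (hT τ))).val :
            (AinfTop.nilTheta F p hθ).toIdeal) : AinfTop F p) := by
        rw [AinfTop.coe_val_divisionLiftPt, AinfTop.coe_val_divisionLiftPt, ← AinfTop.gal_torsionLift E₀ σ (hT τ)]
        rfl
      have hgalι : ∀ x : Ainf (p := p) F, galBmaxZero σ (algebraMap (Ainf (p := p) F) (bmaxZero F p) x) =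
          algebraMap (Ainf (p := p) F) (bmaxZero F p) (galAinf σ x) := fun x => Subtype.ext (galAinfLoc_algebraMap σ x)
      have h2 := congrArg (galBmaxZero σ) (hzf τ)
      rw [map_pow, map_mul, map_natCast, hgalι, hval] at h2
      exact h2
    rw [hcongr] at hzσ ⊢
    exact PadicLogSeries.logSum_congr_witness _ _ hzσ (hzf (σ • τ))

end AinfRamTop

end Literature.NumberTheory.PAdicHodge
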